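import Literature.Analysis.Complex.RectangleResidueSimplePoles
import Literature.Analysis.Complex.RectangleCauchyDerivatives
import HarnessLib

/-!
# The residue theorem on a rectangle for finitely many poles of finite order

Trunk support (`Literature/Analysis/Complex`). The tree has the residue theorem on a rectangle for finitely
many SIMPLE poles (`Literature.Analysis.Complex.rectBoundaryIntegral_eq_sum_of_simplePoles`, file
`RectangleResidueSimplePoles.lean`), for poles of order `≤ 2`
(`Literature.Analysis.Complex.rectBoundaryIntegral_eq_sum_of_doublePoles`, `RectangleResidueDoublePoles.lean`), and
Cauchy's formula for derivatives for ONE pole with numerator holomorphic on the whole rectangle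
(`Literature.Analysis.Complex.rectBoundaryIntegral_div_pow_succ_eq`, `RectangleCauchyDerivatives.lean`). This
file removes the restriction on the order and the number of the poles at once, in the form needed for
Perron-type contour shifts across poles of higher multiplicity (e.g. Broucke–Debruyne–Révész 2023, Theorem 3.2,
where the Beurling zeta function has prescribed poles `ω` of multiplicity `m(ω)` and the residues produce the
terms `x^ω Σ_{j<m(ω)} b_{ω,j} (log x)^j`):

* `Literature.Analysis.Complex.rectBoundaryIntegral_finset_sum` — additivity of the four-term boundary integral
  over a `Finset` of integrands continuous on the boundary;
* `Literature.Analysis.Complex.rectBoundaryIntegral_eq_zero_of_hasDerivAt_off` — if the integrand has a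
  primitive off one interior point, its boundary integral vanishes; hence
  `Literature.Analysis.Complex.rectBoundaryIntegral_div_pow_eq_zero`: `∮ m/(z−p)^{n+2} dz = 0` (`n ≥ 0`), while
  `∮ m/(z−p) dz = 2πi m` (`Literature.Analysis.Complex.rectBoundaryIntegral_div_sub`);
* `Literature.Analysis.Complex.polarPart p n co z = Σ_{k=0}^{n} co k/(z−p)^{k+1}` and
  `Literature.Analysis.Complex.rectBoundaryIntegral_polarPart`: `∮ polarPart = 2πi · co 0`;
* `Literature.Analysis.Complex.rectBoundaryIntegral_eq_sum_of_singularParts` — **the residue theorem**: `K = [a,b]×[c,d]`,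
  `U ⊇ K` open, `S ⊆ K°` finite, `F` differentiable on `U ∖ S`, and at each `p ∈ S` a decomposition `F = g + P` on a
  punctured neighbourhood with `g` differentiable near `p`, `P` differentiable on `ℂ ∖ {p}` and `∮_{∂K} P = 2πi·res p`;
  then `∮_{∂K} F = 2πi Σ_{p∈S} res p`. The specialisations `…_of_polarParts` (`P` a polar part, residue `co p 0`) and
  `…_of_poles` (`F = φ/(z−p)^{n+1}` near `p` with `φ` differentiable near `p`; residue = the Taylor coefficient
  `((swap dslope p)^[n] φ) p` — `= φ^{(n)}(p)/n!` by the tree's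
  `Literature.Analysis.Complex.iterate_dslope_apply_eq_iteratedDeriv_div` — via the algebraic Taylor formula
  `Literature.Analysis.Complex.taylor_dslope`) follow.

Proof of the main theorem: induction on `S`, subtracting at one pole `p` the singular part `P` (which is holomorphic
near the other poles, so their singular data are unchanged up to the differentiable summand `−P`); base case
Cauchy–Goursat. Textbook statement: Conway, *Functions of One Complex Variable I*, V.2.2.

## References

* J. B. Conway, *Functions of One Complex Variable I*, 2nd ed., GTM 11, Springer 1978, Ch. V §2, Thm. 2.2
  (Residue Theorem) and Prop. 2.4 (residue at a pole of order `m`). [Conway1978]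
-/

noncomputable section

open Complex Set MeasureTheory Filter Topology intervalIntegral

namespace Literature.Analysis.Complex

variable {a b c d : ℝ}

/-! ### Additivity over finite sums -/

/-- Additivity of the boundary integral over a `Finset` of integrands continuous at every boundary point.
[folklore] -/
theorem rectBoundaryIntegral_finset_sum {ι : Type*} (T : Finset ι) (G : ι → ℂ → ℂ) (hab : a ≤ b) (hcd : c ≤ d)
    (h_bot : ∀ i ∈ T, ∀ x ∈ Icc a b, ContinuousAt (G i) (x + c * I))
    (h_top : ∀ i ∈ T, ∀ x ∈ Icc a b, ContinuousAt (G i) (x + d * I))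
    (h_left : ∀ i ∈ T, ∀ y ∈ Icc c d, ContinuousAt (G i) (a + y * I))
    (h_right : ∀ i ∈ T, ∀ y ∈ Icc c d, ContinuousAt (G i) (b + y * I)) :
    rectBoundaryIntegral (fun z ↦ ∑ i ∈ T, G i z) a b c d = ∑ i ∈ T, rectBoundaryIntegral (G i) a b c d := by
  classical
  induction T using Finset.induction_on with
  | empty =>
    simp [rectBoundaryIntegral]
  | insert i T hiT ih =>
    have ih' := ih (fun j hj ↦ h_bot j (Finset.mem_insert_of_mem hj))
      (fun j hj ↦ h_top j (Finset.mem_insert_of_mem hj)) (fun j hj ↦ h_left j (Finset.mem_insert_of_mem hj))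
      (fun j hj ↦ h_right j (Finset.mem_insert_of_mem hj))
    have hsumc : ∀ {z : ℂ}, (∀ j ∈ T, ContinuousAt (G j) z) → ContinuousAt (fun w ↦ ∑ j ∈ T, G j w) z :=
      fun hz ↦ tendsto_finsetSum T fun j hj ↦ hz j hj
    have heq : (fun z ↦ ∑ j ∈ insert i T, G j z) = fun z ↦ G i z + ∑ j ∈ T, G j z := by
      funext z; rw [Finset.sum_insert hiT]
    rw [heq, Finset.sum_insert hiT, rectBoundaryIntegral_add hab hcd
      (h_bot i (Finset.mem_insert_self i T)) (h_top i (Finset.mem_insert_self i T))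
      (h_left i (Finset.mem_insert_self i T)) (h_right i (Finset.mem_insert_self i T))
      (fun x hx ↦ hsumc fun j hj ↦ h_bot j (Finset.mem_insert_of_mem hj) x hx)
      (fun x hx ↦ hsumc fun j hj ↦ h_top j (Finset.mem_insert_of_mem hj) x hx)
      (fun y hy ↦ hsumc fun j hj ↦ h_left j (Finset.mem_insert_of_mem hj) y hy)
      (fun y hy ↦ hsumc fun j hj ↦ h_right j (Finset.mem_insert_of_mem hj) y hy), ih']

/-! ### Integrands with a primitive off one interior point -/

/-- A point of the bottom/top line is not the interior point `p`. [folklore] -/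
lemma ofReal_add_mul_I_ne_of_im {p : ℂ} (hp : p ∈ Ioo a b ×ℂ Ioo c d) (x : ℝ) {y : ℝ} (hy : y = c ∨ y = d) :
    (x : ℂ) + y * I ≠ p :=
  ne_of_mem_Ioo_reProdIm_of_im hp (by rcases hy with rfl | rfl <;> simp)

/-- A point of the left/right line is not the interior point `p`. [folklore] -/
lemma ofReal_add_mul_I_ne_of_re {p : ℂ} (hp : p ∈ Ioo a b ×ℂ Ioo c d) {x : ℝ} (hx : x = a ∨ x = b) (y : ℝ) :
    (x : ℂ) + y * I ≠ p :=
  ne_of_mem_Ioo_reProdIm_of_re hp (by rcases hx with rfl | rfl <;> simp)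

/-- **A primitive kills the boundary integral.** If `Φ' = dΦ/dz` at every point `z ≠ p`, `Φ'` is continuous off
`p`, and `p` lies in the open rectangle, then `∮_{∂K} Φ' = 0` (each edge integral is a difference of values of `Φ`,
and the four differences telescope). [folklore] -/
theorem rectBoundaryIntegral_eq_zero_of_hasDerivAt_off {Φ Φ' : ℂ → ℂ} {p : ℂ}
    (hp : p ∈ Ioo a b ×ℂ Ioo c d) (hΦ : ∀ z, z ≠ p → HasDerivAt Φ (Φ' z) z)
    (hΦ' : ∀ z, z ≠ p → ContinuousAt Φ' z) :
    rectBoundaryIntegral Φ' a b c d = 0 := by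
  -- horizontal edges
  have hh : ∀ y : ℝ, (y = c ∨ y = d) →
      ∫ x : ℝ in a..b, Φ' (x + y * I) = Φ (b + y * I) - Φ (a + y * I) := by
    intro y hy
    have hne : ∀ x : ℝ, (x : ℂ) + y * I ≠ p := fun x ↦ ofReal_add_mul_I_ne_of_im hp x hy
    have hderiv : ∀ x ∈ uIcc a b, HasDerivAt (fun t : ℝ ↦ Φ (t + y * I)) (Φ' (x + y * I)) x := by
      intro x _
      have h1 : HasDerivAt (fun w : ℂ ↦ w + y * I) 1 (x : ℂ) := (hasDerivAt_id (x : ℂ)).add_const _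
      have h2 : HasDerivAt (fun w : ℂ ↦ Φ (w + y * I)) (Φ' (x + y * I) * 1) (x : ℂ) :=
        (hΦ _ (hne x)).comp (x : ℂ) h1
      rw [mul_one] at h2
      exact h2.comp_ofReal
    have hcont : ContinuousOn (fun x : ℝ ↦ Φ' (x + y * I)) (uIcc a b) := by
      intro x _
      have h1 : ContinuousAt (fun x : ℝ ↦ (x : ℂ) + y * I) x := by fun_prop
      exact ((hΦ' _ (hne x)).comp (f := fun x : ℝ ↦ (x : ℂ) + y * I) h1).continuousWithinAt
    simpa using integral_eq_sub_of_hasDerivAt hderiv hcont.intervalIntegrable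
  -- vertical edges
  have hv : ∀ x : ℝ, (x = a ∨ x = b) →
      I * ∫ y : ℝ in c..d, Φ' (x + y * I) = Φ (x + d * I) - Φ (x + c * I) := by
    intro x hx
    have hne : ∀ y : ℝ, (x : ℂ) + y * I ≠ p := fun y ↦ ofReal_add_mul_I_ne_of_re hp hx y
    have hderiv : ∀ y ∈ uIcc c d, HasDerivAt (fun t : ℝ ↦ Φ (x + t * I)) (I * Φ' (x + y * I)) y := by
      intro y _
      have h1 : HasDerivAt (fun w : ℂ ↦ (x : ℂ) + w * I) (1 * I) (y : ℂ) :=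
        ((hasDerivAt_id (y : ℂ)).mul_const I).const_add _
      have h2 : HasDerivAt (fun w : ℂ ↦ Φ (x + w * I)) (Φ' (x + y * I) * (1 * I)) (y : ℂ) :=
        (hΦ _ (hne y)).comp (y : ℂ) h1
      have h3 := h2.comp_ofReal
      convert h3 using 1
      ring
    have hcont : ContinuousOn (fun y : ℝ ↦ I * Φ' (x + y * I)) (uIcc c d) := by
      intro y _
      have h1 : ContinuousAt (fun y : ℝ ↦ (x : ℂ) + y * I) y := by fun_prop
      exact (((hΦ' _ (hne y)).comp (f := fun y : ℝ ↦ (x : ℂ) + y * I) h1).const_mul I).continuousWithinAt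
    rw [← intervalIntegral.integral_const_mul]
    simpa using integral_eq_sub_of_hasDerivAt hderiv hcont.intervalIntegrable
  rw [rectBoundaryIntegral_def, hh c (Or.inl rfl), hh d (Or.inr rfl), hv b (Or.inr rfl), hv a (Or.inl rfl)]
  ring

/-- **Higher negative powers have zero boundary integral**: `∮_{∂K} m/(z−p)^{n+2} dz = 0` for `p` in the open
rectangle and every `n ≥ 0` (the primitive `−m/((n+1)(z−p)^{n+1})` is single valued). [folklore] -/
theorem rectBoundaryIntegral_div_pow_eq_zero (m : ℂ) {p : ℂ} (n : ℕ) (hp : p ∈ Ioo a b ×ℂ Ioo c d) :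
    rectBoundaryIntegral (fun z ↦ m / (z - p) ^ (n + 2)) a b c d = 0 := by
  have hn1 : ((n : ℂ) + 1) ≠ 0 := Nat.cast_add_one_ne_zero n
  refine rectBoundaryIntegral_eq_zero_of_hasDerivAt_off (Φ := fun z ↦ -m / ((n : ℂ) + 1) * ((z - p) ^ (n + 1))⁻¹)
    hp (fun z hz ↦ ?_) (fun z hz ↦ ?_)
  · have hzp : z - p ≠ 0 := sub_ne_zero.2 hz
    have h1 : HasDerivAt (fun w : ℂ ↦ (w - p) ^ (n + 1)) (((n + 1 : ℕ) : ℂ) * (z - p) ^ (n + 1 - 1) * 1) z :=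
      ((hasDerivAt_id z).sub_const p).fun_pow (n + 1)
    have h2 : HasDerivAt (fun w : ℂ ↦ ((w - p) ^ (n + 1))⁻¹)
        (-(((n + 1 : ℕ) : ℂ) * (z - p) ^ (n + 1 - 1) * 1) / ((z - p) ^ (n + 1)) ^ 2) z :=
      h1.inv (pow_ne_zero _ hzp)
    have h3 := h2.const_mul (-m / ((n : ℂ) + 1))
    have hval : -m / ((n : ℂ) + 1) * (-(((n + 1 : ℕ) : ℂ) * (z - p) ^ (n + 1 - 1) * 1) / ((z - p) ^ (n + 1)) ^ 2) =
        m / (z - p) ^ (n + 2) := by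
      rw [Nat.add_sub_cancel]
      have hp1 : (z - p) ^ (n + 1) ≠ 0 := pow_ne_zero _ hzp
      have hp2 : (z - p) ^ (n + 2) ≠ 0 := pow_ne_zero _ hzp
      push_cast
      field_simp
      ring
    rw [hval] at h3
    exact h3
  · exact (continuousAt_const.div ((continuousAt_id.sub continuousAt_const).pow _)
      (pow_ne_zero _ (sub_ne_zero.2 hz)))

/-- **Winding number**, division form: `∮_{∂K} m/(z−p) dz = 2πi m` for `p` in the open rectangle. [folklore] -/
theorem rectBoundaryIntegral_div_sub (m : ℂ) {p : ℂ} (hp : p ∈ Ioo a b ×ℂ Ioo c d) :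
    rectBoundaryIntegral (fun z ↦ m / (z - p)) a b c d = 2 * Real.pi * I * m := by
  have h := rectBoundaryIntegral_const_mul_inv_sub m p hp.1.1 hp.1.2 hp.2.1 hp.2.2
  simpa [div_eq_mul_inv] using h

/-! ### Polar parts -/

/-- The **polar part** of order `n + 1` at `p` with coefficients `co 0, …, co n`:
`polarPart p n co z = Σ_{k=0}^{n} co k / (z − p)^{k+1}`; its residue is `co 0`. [cite: Conway1978, Ch. V §2] -/
def polarPart (p : ℂ) (n : ℕ) (co : ℕ → ℂ) (z : ℂ) : ℂ :=
  ∑ k ∈ Finset.range (n + 1), co k / (z - p) ^ (k + 1)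

/-- A simple polar part: `polarPart p 0 co z = co 0/(z − p)`. [folklore] -/
theorem polarPart_zero (p : ℂ) (co : ℕ → ℂ) (z : ℂ) : polarPart p 0 co z = co 0 / (z - p) := by
  simp [polarPart]

/-- Peeling off the top term: `polarPart p (n+1) co z = polarPart p n co z + co (n+1)/(z−p)^{n+2}`. [folklore] -/
theorem polarPart_succ (p : ℂ) (n : ℕ) (co : ℕ → ℂ) (z : ℂ) :
    polarPart p (n + 1) co z = polarPart p n co z + co (n + 1) / (z - p) ^ (n + 2) := by
  rw [polarPart, Finset.sum_range_succ, polarPart]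

/-- A polar part is differentiable off its pole. [folklore] -/
theorem differentiableAt_polarPart (p : ℂ) (n : ℕ) (co : ℕ → ℂ) {z : ℂ} (hz : z ≠ p) :
    DifferentiableAt ℂ (polarPart p n co) z := by
  have heq : polarPart p n co = fun w ↦ ∑ k ∈ Finset.range (n + 1), co k / (w - p) ^ (k + 1) := rfl
  rw [heq]
  exact DifferentiableAt.fun_sum fun k _ ↦ (differentiableAt_const _).div
    ((differentiableAt_id.sub_const p).pow _) (pow_ne_zero _ (sub_ne_zero.2 hz))

/-- A polar part is continuous off its pole. [folklore] -/
theorem continuousAt_polarPart (p : ℂ) (n : ℕ) (co : ℕ → ℂ) {z : ℂ} (hz : z ≠ p) :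
    ContinuousAt (polarPart p n co) z :=
  (differentiableAt_polarPart p n co hz).continuousAt

/-- **`∮_{∂K} polarPart = 2πi · co 0`** for a pole in the open rectangle: only the term `co 0/(z−p)` winds.
[cite: Conway1978, Ch. V §2] -/
theorem rectBoundaryIntegral_polarPart {p : ℂ} (n : ℕ) (co : ℕ → ℂ) (hab : a < b) (hcd : c < d)
    (hp : p ∈ Ioo a b ×ℂ Ioo c d) :
    rectBoundaryIntegral (polarPart p n co) a b c d = 2 * Real.pi * I * co 0 := by
  induction n with
  | zero =>
    have heq : polarPart p 0 co = fun z ↦ co 0 / (z - p) := funext fun z ↦ polarPart_zero p co z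
    rw [heq, rectBoundaryIntegral_div_sub (co 0) hp]
  | succ n ih =>
    have heq : polarPart p (n + 1) co = fun z ↦ polarPart p n co z + co (n + 1) / (z - p) ^ (n + 2) :=
      funext fun z ↦ polarPart_succ p n co z
    have hc1 : ∀ {z : ℂ}, z ≠ p → ContinuousAt (polarPart p n co) z := fun hz ↦ continuousAt_polarPart p n co hz
    have hc2 : ∀ {z : ℂ}, z ≠ p → ContinuousAt (fun w ↦ co (n + 1) / (w - p) ^ (n + 2)) z := fun hz ↦
      continuousAt_const.div ((continuousAt_id.sub continuousAt_const).pow _) (pow_ne_zero _ (sub_ne_zero.2 hz))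
    rw [heq, rectBoundaryIntegral_add hab.le hcd.le
      (fun x _ ↦ hc1 (ofReal_add_mul_I_ne_of_im hp x (Or.inl rfl)))
      (fun x _ ↦ hc1 (ofReal_add_mul_I_ne_of_im hp x (Or.inr rfl)))
      (fun y _ ↦ hc1 (ofReal_add_mul_I_ne_of_re hp (Or.inl rfl) y))
      (fun y _ ↦ hc1 (ofReal_add_mul_I_ne_of_re hp (Or.inr rfl) y))
      (fun x _ ↦ hc2 (ofReal_add_mul_I_ne_of_im hp x (Or.inl rfl)))
      (fun x _ ↦ hc2 (ofReal_add_mul_I_ne_of_im hp x (Or.inr rfl)))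
      (fun y _ ↦ hc2 (ofReal_add_mul_I_ne_of_re hp (Or.inl rfl) y))
      (fun y _ ↦ hc2 (ofReal_add_mul_I_ne_of_re hp (Or.inr rfl) y)),
      ih, rectBoundaryIntegral_div_pow_eq_zero (co (n + 1)) n hp, add_zero]

/-! ### The residue theorem -/

/-- **Residue theorem on a rectangle, finitely many poles with given singular parts.** Let `K = [a,b] × [c,d]`
(`a < b`, `c < d`), `U ⊇ K` open, `S ⊆ K°` finite, `F` complex differentiable on `U ∖ S`, and suppose that for
every `p ∈ S` there are `g`, `P` and a neighbourhood `V` of `p` with `g` differentiable on `V`, `P` differentiable at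
every `z ≠ p`, `∮_{∂K} P = 2πi · res p`, and `F = g + P` on `V ∖ {p}`. Then `∮_{∂K} F = 2πi Σ_{p∈S} res p`
(four-term convention of Mathlib). The values of `F` on `S` are irrelevant. [cite: Conway1978, Ch. V Thm. 2.2] -/
theorem rectBoundaryIntegral_eq_sum_of_singularParts (hab : a < b) (hcd : c < d) (S : Finset ℂ) :
    ∀ (F : ℂ → ℂ) (res : ℂ → ℂ) (U : Set ℂ), IsOpen U → Icc a b ×ℂ Icc c d ⊆ U →
      ((S : Set ℂ) ⊆ Ioo a b ×ℂ Ioo c d) →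
      DifferentiableOn ℂ F (U \ ↑S) →
      (∀ p ∈ S, ∃ g P : ℂ → ℂ, ∃ V ∈ 𝓝 p, DifferentiableOn ℂ g V ∧ (∀ z, z ≠ p → DifferentiableAt ℂ P z) ∧
          rectBoundaryIntegral P a b c d = 2 * Real.pi * I * res p ∧ ∀ z ∈ V, z ≠ p → F z = g z + P z) →
      rectBoundaryIntegral F a b c d = 2 * Real.pi * I * ∑ p ∈ S, res p := by
  classical
  induction S using Finset.induction_on with
  | empty =>
    intro F res U _ hKU _ hF _
    have hd : DifferentiableOn ℂ F (Icc a b ×ℂ Icc c d) := hF.mono (by simpa using hKU)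
    rw [rectBoundaryIntegral_eq_zero_of_differentiableOn hab.le hcd.le hd]
    simp
  | insert p S' hpS' ih =>
    intro F res U hU hKU hsub hF hpole
    have hpK : p ∈ Ioo a b ×ℂ Ioo c d := hsub (Finset.mem_insert_self p S')
    obtain ⟨g, P, V, hV, hg, hPd, hPint, hFg⟩ := hpole p (Finset.mem_insert_self p S')
    have hsub' : ((S' : Set ℂ) ⊆ Ioo a b ×ℂ Ioo c d) := fun q hq ↦ hsub (Finset.mem_insert_of_mem hq)
    have hpS'c : ∀ q ∈ S', q ≠ p := fun q hq h ↦ hpS' (h ▸ hq)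
    -- the corrected function `F₁ = F - P`, filled in at `p`
    set F₁ : ℂ → ℂ := fun z ↦ if z = p then g p else F z - P z with hF₁
    have hF₁_of_ne : ∀ {z : ℂ}, z ≠ p → F₁ z = F z - P z := fun hz ↦ by simp [hF₁, hz]
    have hF₁V : ∀ z ∈ V, F₁ z = g z := by
      intro z hz
      by_cases hzp : z = p
      · rw [hzp]; simp [hF₁]
      · rw [hF₁_of_ne hzp, hFg z hz hzp]; ring
    have hF₁p : DifferentiableAt ℂ F₁ p := by
      refine (hg.differentiableAt hV).congr_of_eventuallyEq ?_
      filter_upwards [hV] with z hz using hF₁V z hz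
    have hOpen : IsOpen (U \ ↑(insert p S')) := hU.sdiff (Finset.finite_toSet _).isClosed
    have hFat : ∀ {z : ℂ}, z ∈ U → z ∉ insert p S' → DifferentiableAt ℂ F z := by
      intro z hzU hzS
      exact hF.differentiableAt (hOpen.mem_nhds ⟨hzU, by simpa using hzS⟩)
    have hF₁d : DifferentiableOn ℂ F₁ (U \ ↑S') := by
      intro z hz
      apply DifferentiableAt.differentiableWithinAt
      by_cases hzp : z = p
      · rw [hzp]; exact hF₁p
      · have hzS : z ∉ insert p S' := by
          simp only [Finset.mem_insert, not_or]
          exact ⟨hzp, by simpa using hz.2⟩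
        have hG : DifferentiableAt ℂ (fun w ↦ F w - P w) z := (hFat hz.1 hzS).sub (hPd z hzp)
        refine hG.congr_of_eventuallyEq ?_
        filter_upwards [isOpen_ne.mem_nhds hzp] with w hw using hF₁_of_ne hw
    -- the singular data of `F₁` at the remaining poles
    have hpole₁ : ∀ q ∈ S', ∃ g₁ P₁ : ℂ → ℂ, ∃ W ∈ 𝓝 q, DifferentiableOn ℂ g₁ W ∧
        (∀ z, z ≠ q → DifferentiableAt ℂ P₁ z) ∧ rectBoundaryIntegral P₁ a b c d = 2 * Real.pi * I * res q ∧
        ∀ z ∈ W, z ≠ q → F₁ z = g₁ z + P₁ z := by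
      intro q hq
      have hqp : q ≠ p := hpS'c q hq
      obtain ⟨ψ, P₁, W, hW, hψ, hP₁d, hP₁int, hFψ⟩ := hpole q (Finset.mem_insert_of_mem hq)
      refine ⟨fun z ↦ ψ z - P z, P₁, W ∩ {z | z ≠ p}, inter_mem hW (isOpen_ne.mem_nhds hqp), ?_, hP₁d,
        hP₁int, ?_⟩
      · intro z hz
        exact ((hψ z hz.1).sub (hPd z hz.2).differentiableWithinAt).mono inter_subset_left
      · intro z hz hzq
        rw [hF₁_of_ne hz.2, hFψ z hz.1 hzq]
        ring
    have hI := ih F₁ res U hU hKU hsub' hF₁d hpole₁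
    -- continuity of the two pieces on `∂K`
    have hbdy : ∀ {z : ℂ}, z ∈ Icc a b ×ℂ Icc c d → (z.im = c ∨ z.im = d) ∨ (z.re = a ∨ z.re = b) →
        ContinuousAt F₁ z ∧ ContinuousAt P z ∧ F z = F₁ z + P z := by
      intro z hzK hz
      have hzp : z ≠ p := by
        rcases hz with h | h
        · exact ne_of_mem_Ioo_reProdIm_of_im hpK h
        · exact ne_of_mem_Ioo_reProdIm_of_re hpK h
      have hzS' : z ∉ (S' : Set ℂ) := by
        intro h
        have h' := hsub' h
        rw [mem_reProdIm] at h'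
        rcases hz with (h1 | h1) | (h1 | h1)
        · linarith [h'.2.1]
        · linarith [h'.2.2]
        · linarith [h'.1.1]
        · linarith [h'.1.2]
      have hzU : z ∈ U := hKU hzK
      refine ⟨?_, (hPd z hzp).continuousAt, ?_⟩
      · exact (hF₁d.differentiableAt ((hU.sdiff (Finset.finite_toSet _).isClosed).mem_nhds
          ⟨hzU, hzS'⟩)).continuousAt
      · rw [hF₁_of_ne hzp]; ring
    have memK_h : ∀ {x : ℝ} (y : ℝ), x ∈ Icc a b → (y = c ∨ y = d) → (x : ℂ) + y * I ∈ Icc a b ×ℂ Icc c d := by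
      intro x y hx hy
      rw [mem_reProdIm]
      refine ⟨by simpa using hx, ?_⟩
      rcases hy with rfl | rfl <;> simp [hcd.le]
    have memK_v : ∀ (x : ℝ) {y : ℝ}, (x = a ∨ x = b) → y ∈ Icc c d → (x : ℂ) + y * I ∈ Icc a b ×ℂ Icc c d := by
      intro x y hx hy
      rw [mem_reProdIm]
      refine ⟨?_, by simpa using hy⟩
      rcases hx with rfl | rfl <;> simp [hab.le]
    have him : ∀ (x y : ℝ), ((x : ℂ) + y * I).im = y := fun x y ↦ by simp
    have hre : ∀ (x y : ℝ), ((x : ℂ) + y * I).re = x := fun x y ↦ by simp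
    -- assemble
    have hcongr : rectBoundaryIntegral F a b c d =
        rectBoundaryIntegral (fun z ↦ F₁ z + P z) a b c d := by
      refine rectBoundaryIntegral_congr hab.le hcd.le (fun x hx ↦ ?_) (fun x hx ↦ ?_)
        (fun y hy ↦ ?_) (fun y hy ↦ ?_)
      · exact (hbdy (memK_h c hx (Or.inl rfl)) (Or.inl (Or.inl (him x c)))).2.2
      · exact (hbdy (memK_h d hx (Or.inr rfl)) (Or.inl (Or.inr (him x d)))).2.2
      · exact (hbdy (memK_v a (Or.inl rfl) hy) (Or.inr (Or.inl (hre a y)))).2.2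
      · exact (hbdy (memK_v b (Or.inr rfl) hy) (Or.inr (Or.inr (hre b y)))).2.2
    have hadd : rectBoundaryIntegral (fun z ↦ F₁ z + P z) a b c d =
        rectBoundaryIntegral F₁ a b c d + rectBoundaryIntegral P a b c d :=
      rectBoundaryIntegral_add hab.le hcd.le
        (fun x hx ↦ (hbdy (memK_h c hx (Or.inl rfl)) (Or.inl (Or.inl (him x c)))).1)
        (fun x hx ↦ (hbdy (memK_h d hx (Or.inr rfl)) (Or.inl (Or.inr (him x d)))).1)
        (fun y hy ↦ (hbdy (memK_v a (Or.inl rfl) hy) (Or.inr (Or.inl (hre a y)))).1)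
        (fun y hy ↦ (hbdy (memK_v b (Or.inr rfl) hy) (Or.inr (Or.inr (hre b y)))).1)
        (fun x hx ↦ (hbdy (memK_h c hx (Or.inl rfl)) (Or.inl (Or.inl (him x c)))).2.1)
        (fun x hx ↦ (hbdy (memK_h d hx (Or.inr rfl)) (Or.inl (Or.inr (him x d)))).2.1)
        (fun y hy ↦ (hbdy (memK_v a (Or.inl rfl) hy) (Or.inr (Or.inl (hre a y)))).2.1)
        (fun y hy ↦ (hbdy (memK_v b (Or.inr rfl) hy) (Or.inr (Or.inr (hre b y)))).2.1)
    rw [hcongr, hadd, hI, hPint, Finset.sum_insert hpS']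
    ring

/-- **Residue theorem on a rectangle, poles given by polar parts**: as
`rectBoundaryIntegral_eq_sum_of_singularParts`, with `F = g + polarPart p (n p) (co p)` near each `p ∈ S`; the
residues are the coefficients `co p 0`. [cite: Conway1978, Ch. V Thm. 2.2] -/
theorem rectBoundaryIntegral_eq_sum_of_polarParts (hab : a < b) (hcd : c < d) (S : Finset ℂ) (F : ℂ → ℂ)
    (n : ℂ → ℕ) (co : ℂ → ℕ → ℂ) (U : Set ℂ) (hU : IsOpen U) (hKU : Icc a b ×ℂ Icc c d ⊆ U)
    (hS : (S : Set ℂ) ⊆ Ioo a b ×ℂ Ioo c d) (hF : DifferentiableOn ℂ F (U \ ↑S))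
    (hpole : ∀ p ∈ S, ∃ g : ℂ → ℂ, ∃ V ∈ 𝓝 p, DifferentiableOn ℂ g V ∧
        ∀ z ∈ V, z ≠ p → F z = g z + polarPart p (n p) (co p) z) :
    rectBoundaryIntegral F a b c d = 2 * Real.pi * I * ∑ p ∈ S, co p 0 := by
  refine rectBoundaryIntegral_eq_sum_of_singularParts hab hcd S F (fun p ↦ co p 0) U hU hKU hS hF
    fun p hp ↦ ?_
  obtain ⟨g, V, hV, hg, hFg⟩ := hpole p hp
  exact ⟨g, polarPart p (n p) (co p), V, hV, hg, fun z hz ↦ differentiableAt_polarPart p (n p) (co p) hz,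
    rectBoundaryIntegral_polarPart (n p) (co p) hab hcd (hS hp), hFg⟩

/-! ### Poles of order `n + 1` with differentiable numerator: Taylor coefficients via `dslope` -/

/-- **The algebraic Taylor formula**: for every function `φ : ℂ → ℂ`, centre `p`, order `n` and EVERY `z`,
`φ z = Σ_{j<n} ((swap dslope p)^[j] φ) p · (z−p)^j + (z−p)^n · ((swap dslope p)^[n] φ) z` — an identity, by
`(z − p) · dslope φ p z = φ z − φ p` iterated. [folklore] -/
theorem taylor_dslope (φ : ℂ → ℂ) (p : ℂ) (n : ℕ) (z : ℂ) :
    φ z = ∑ j ∈ Finset.range n, (Function.swap dslope p)^[j] φ p * (z - p) ^ j +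
      (z - p) ^ n * (Function.swap dslope p)^[n] φ z := by
  induction n generalizing φ with
  | zero => simp
  | succ n ih =>
    have h := ih (Function.swap dslope p φ)
    have h0 : φ z = φ p + (z - p) * Function.swap dslope p φ z := by
      have := sub_smul_dslope φ p z
      rw [smul_eq_mul] at this
      show φ z = φ p + (z - p) * dslope φ p z
      rw [this]; ring
    rw [Finset.sum_range_succ', Function.iterate_zero_apply, pow_zero, mul_one, h0, h, mul_add, Finset.mul_sum]
    simp only [Function.iterate_succ_apply]
    have e1 : ∀ j : ℕ, (z - p) * ((Function.swap dslope p)^[j] (Function.swap dslope p φ) p * (z - p) ^ j) =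
        (Function.swap dslope p)^[j] (Function.swap dslope p φ) p * (z - p) ^ (j + 1) := by
      intro j; ring
    simp only [e1]
    ring

/-- **A pole of order `n+1` with differentiable numerator has a polar part**: if `φ` is differentiable on a
neighbourhood `V` of `p`, then on `V ∖ {p}`,
`φ z/(z−p)^{n+1} = ((swap dslope p)^[n+1] φ) z + polarPart p n (k ↦ ((swap dslope p)^[n−k] φ) p) z`.
[cite: Conway1978, Ch. V Prop. 2.4] -/
theorem div_pow_eq_add_polarPart (φ : ℂ → ℂ) (p : ℂ) (n : ℕ) {z : ℂ} (hz : z ≠ p) :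
    φ z / (z - p) ^ (n + 1) = (Function.swap dslope p)^[n + 1] φ z +
      polarPart p n (fun k ↦ (Function.swap dslope p)^[n - k] φ p) z := by
  have hzp : z - p ≠ 0 := sub_ne_zero.2 hz
  have h := taylor_dslope φ p (n + 1) z
  rw [h, add_div, mul_div_cancel_left₀ _ (pow_ne_zero _ hzp), add_comm, polarPart,
    Finset.sum_div]
  congr 1
  -- reindex `j ↦ n - j`
  rw [← Finset.sum_range_reflect]
  refine Finset.sum_congr rfl fun k hk ↦ ?_
  have hk' : k ≤ n := Nat.lt_succ_iff.mp (Finset.mem_range.mp hk)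
  rw [show n + 1 - 1 - k = n - k from by omega]
  have hpow : (z - p) ^ (n + 1) = (z - p) ^ (n - k) * (z - p) ^ (k + 1) := by
    rw [← pow_add]; congr 1; omega
  rw [hpow, mul_comm ((Function.swap dslope p)^[n - k] φ p), mul_div_mul_left _ _ (pow_ne_zero _ hzp)]

/-- **Residue theorem on a rectangle, poles of finite order with differentiable numerators.** Let
`K = [a,b] × [c,d]`, `U ⊇ K` open, `S ⊆ K°` finite, `F` differentiable on `U ∖ S`, and at each `p ∈ S` let
`F(z) = φ_p(z)/(z − p)^{n(p)+1}` on a punctured neighbourhood, `φ_p` differentiable near `p`. Then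
`∮_{∂K} F = 2πi Σ_{p∈S} ((swap dslope p)^[n p] φ_p) p` — the residue at a pole of order `n+1` is the `n`-th Taylor
coefficient of the numerator ("`Res = g^{(m−1)}(a)/(m−1)!`"). For `n = 0` this is
`rectBoundaryIntegral_eq_sum_of_simplePoles`. [cite: Conway1978, Ch. V Thm. 2.2 and Prop. 2.4] -/
theorem rectBoundaryIntegral_eq_sum_of_poles (hab : a < b) (hcd : c < d) (S : Finset ℂ) (F : ℂ → ℂ)
    (n : ℂ → ℕ) (φ : ℂ → ℂ → ℂ) (U : Set ℂ) (hU : IsOpen U) (hKU : Icc a b ×ℂ Icc c d ⊆ U)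
    (hS : (S : Set ℂ) ⊆ Ioo a b ×ℂ Ioo c d) (hF : DifferentiableOn ℂ F (U \ ↑S))
    (hpole : ∀ p ∈ S, ∃ V ∈ 𝓝 p, DifferentiableOn ℂ (φ p) V ∧
        ∀ z ∈ V, z ≠ p → F z = φ p z / (z - p) ^ (n p + 1)) :
    rectBoundaryIntegral F a b c d =
      2 * Real.pi * I * ∑ p ∈ S, (Function.swap dslope p)^[n p] (φ p) p := by
  have h := rectBoundaryIntegral_eq_sum_of_polarParts hab hcd S F n
    (fun p k ↦ (Function.swap dslope p)^[n p - k] (φ p) p) U hU hKU hS hF fun p hp ↦ ?_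
  · simpa using h
  · obtain ⟨V, hV, hφ, hFφ⟩ := hpole p hp
    exact ⟨(Function.swap dslope p)^[n p + 1] (φ p), V, hV, differentiableOn_iterate_dslope hV hφ _,
      fun z hz hzp ↦ by rw [hFφ z hz hzp, div_pow_eq_add_polarPart (φ p) p (n p) hzp]⟩

/-- **Residue theorem on a rectangle, poles of finite order, residues as derivatives**: under the hypotheses
of `rectBoundaryIntegral_eq_sum_of_poles`,
`∮_{∂K} F = 2πi Σ_{p∈S} φ_p^{(n(p))}(p)/n(p)!` ("`Res_{z=a} f = g^{(m−1)}(a)/(m−1)!` for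
`f = g/(z−a)^m`"). [cite: Conway1978, Ch. V Prop. 2.4] -/
theorem rectBoundaryIntegral_eq_sum_of_poles_iteratedDeriv (hab : a < b) (hcd : c < d) (S : Finset ℂ)
    (F : ℂ → ℂ) (n : ℂ → ℕ) (φ : ℂ → ℂ → ℂ) (U : Set ℂ) (hU : IsOpen U) (hKU : Icc a b ×ℂ Icc c d ⊆ U)
    (hS : (S : Set ℂ) ⊆ Ioo a b ×ℂ Ioo c d) (hF : DifferentiableOn ℂ F (U \ ↑S))
    (hpole : ∀ p ∈ S, ∃ V ∈ 𝓝 p, DifferentiableOn ℂ (φ p) V ∧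
        ∀ z ∈ V, z ≠ p → F z = φ p z / (z - p) ^ (n p + 1)) :
    rectBoundaryIntegral F a b c d =
      2 * Real.pi * I * ∑ p ∈ S, iteratedDeriv (n p) (φ p) p / ((n p).factorial : ℂ) := by
  rw [rectBoundaryIntegral_eq_sum_of_poles hab hcd S F n φ U hU hKU hS hF hpole]
  congr 1
  refine Finset.sum_congr rfl fun p hp ↦ ?_
  obtain ⟨V, hV, hφ, -⟩ := hpole p hp
  exact iterate_dslope_apply_eq_iteratedDeriv_div hV hφ (n p)

end Literature.Analysis.Complex
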